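import Literature.NumberTheory.Rogawski1990.ArchDeltaTransferCentralVanishing   -- ★ p841993 (3Z): `archDeltaTransfer_apply_center_eq_zero` — (S-c) CENTRAL VANISHING (the type of SdArch's `stub_ScCore`)
import HarnessLib

/-!
# (S-c) OVER ALL FRAMES, CLOSED: `ArchTransfersSingularOfCanonicalClosed` HOLDS — #77 ⟹ #77-s behind the ray ∕ place ∕ (S-d) binders, for every CM field, form and factor
# (Rogawski 1990, §14.5 Lemma 14.5.2 (c) p. 238; p. 239)

Topic `NumberTheory/Rogawski1990`; namespace `Literature.NumberTheory.Rogawski1990`.  THEOREMS ONLY (no `def`, no instance, no notation, no axiom, no named fact, no `sorry`).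
Cell `pub/hodgecm-mathlib`, ENGINE T1 (crux H413 = `stmt-HodgeConjecture-24833`).  LINK 2 of LEAD WORD T8-113 ∕ desk RULING D25: the head
**`archTransfersSingularOfCanonicalClosed_of_centralVanishing : ArchTransfersSingularOfCanonicalClosed`** (★ `ArchTransfersSingularOfCanonical`, the registered statement of
`stub_Sc` of `Cruxes/H413/Lines/F0_U3LettersRung1.lean`, TOKEN FOR TOKEN and hypothesis-free) — the composition `archTransfersSingularOfCanonicalClosed_of` of the SdArch pay-down
line (:239–:246) with its `stub_ScCore` replaced by ★ `archDeltaTransfer_apply_center_eq_zero` (3Z, p841993).  The (S-d) clause of #77-s is the letter's own binder `hSd`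
(`ArchCentralValueTransfer`, consumed from the Closed statement's hypotheses), so this file does NOT depend on `stub_SdCanonical` ∕ R4.  Author F0P3a-p03 (g11), 2026-09-01.
HONEST LABEL: HC_CM is proved only modulo the printed citations until rung 0 closes; this file pays the closer's stub `stub_Sc` by name (ED. 23 «Sc CLOSED», desk D25) and is otherwise
count-neutral.

## References
* [Rogawski1990] J. D. Rogawski, *Automorphic Representations of Unitary Groups in Three Variables*, Ann. of Math. Stud. 123 (1990), §14.5 Lemma 14.5.2 (c) p. 238; p. 239; §8.4.
* [Shelstad1979] D. Shelstad, *Characters and inner forms of a quasi-split group over ℝ*, Compositio Math. 39 (1979), Thm. 4.7.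
-/

set_option autoImplicit false

noncomputable section

open MeasureTheory NumberField NumberField.InfinitePlace IsDedekindDomain
open Literature.MeasureTheory.Group

namespace Literature.NumberTheory.Rogawski1990

open Literature.NumberTheory.Automorphic Literature.NumberTheory.GaloisRepresentations
open Literature.AlgebraicGeometry.ShimuraVarieties (unitaryGroup hermForm)

set_option maxHeartbeats 400000 in
-- heartbeat budget: latent 160k–200k elaboration cliff (custody N2, buildfix bf1-g41); 0 statement∕proof bytes changed
/-- **(S-c) CLOSED: `ArchTransfersSingularOfCanonicalClosed` holds.**  For every CM field `L`, form `H′`, archimedean factor `T`, orbit σ-algebras and right-invariant Haar measures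
`ν′, ν, νH`: behind the ray (`T.Δ = c · Δ″_∞`, `μ` unitary with `μ|_{𝔸_F^×} = ω`), place (`hP`) and (S-d) (`hSd : ArchCentralValueTransfer …`) binders, #77 `ArchTransfersExistCanonical`
implies #77-s `ArchTransfersExistCanonicalSingular` — the ∃-witnesses of #77 are kept, its thirteen conjuncts carried, the (S-c) central vanishing is ★ `archDeltaTransfer_apply_center_eq_zero`
(Lemma 14.5.2 (c) at `∞`, 3Z) at that system, and the (S-d) clause is the binder `hSd` at that system.  The type is the registered statement of the closer's `stub_Sc` (by-name pay-down).
[cite: Rogawski1990, §14.5 Lemma 14.5.2 (c) p. 238; p. 239] [cite: Shelstad1979, Thm. 4.7] -/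
theorem archTransfersSingularOfCanonicalClosed_of_centralVanishing : ArchTransfersSingularOfCanonicalClosed := by
  intro L _ _ _ H' T _ _ _ _ _ _ ν' ν νH _ _ _ _ _ _ μω hμu hμω c hc hT hP hSd h77 hherm hanis
  obtain ⟨m', m, mH, t', t, tH, h1, h2, h3, h4, h5, h6, h7, h8, h9, h10, h11, h12, h13⟩ := h77 hherm hanis
  refine ⟨m', m, mH, t', t, tH, h1, h2, h3, h4, h5, h6, h7, h8, h9, h10, h11, h12, h13, ?_, ?_⟩
  · exact archDeltaTransfer_apply_center_eq_zero L H' T ν' ν νH μω hμu hμω c hc hT hP hherm hanis m' m mH t' t tH ⟨h1, h2, h3, h4, h5, h6, h7, h8, h9, h10, h11, h12, h13⟩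
  · intro a' a ha' ha hrel γ₀ γ ζ hγ₀ hγ
    exact hSd hherm hanis (hP hherm hanis) m' m mH t' t tH ⟨h1, h2, h3, h4, h5, h6, h7, h8, h9, h10, h11, h12, h13⟩ a' a ha' ha hrel γ₀ γ ζ hγ₀ hγ

end Literature.NumberTheory.Rogawski1990

end
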